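/-
COR-CM (cell pub-hodgecm2 = stage 2 of the Hodge ladder), binder seat b14 (prover-pub-hodgecm2-b14-g4-0, 2026-08-20):
NON-VACUITY of the period statements IN THE TREE.  Tree counterpart of the stage-1 package's kernel files
`HodgeCM/Model/ToyG2/LevelExists.lean` (`Level.nonempty`) and `HodgeCM/Model/Inhabited.lean` (`faceHypothesesInhabited`),
re-proved over the tree's own lemmas (Minkowski: `ShimuraVarieties.torsionFree_principalCongruenceSubgroup`; adelic levels:
`UnitaryGroup.finCongruenceLevel`, `arithmeticLevel_finCongruenceLevel_span`; Landherr: `landherr_exists_proof`; rfwf Lemma 2.1: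
`StubTree.admissible_exists`).  Theorems only: no definition, no named fact, no instance.
-/
import Summits.HodgeConjecture.CorCM.StubTree.Combinatorics
import Summits.HodgeConjecture.CorCM.Proofs.Landherr
import Literature.AlgebraicGeometry.ShimuraVarieties.PrincipalCongruenceSubgroupTorsionFree
import Literature.NumberTheory.Automorphic.PicardUnitaryDatumWitness
import Mathlib.NumberTheory.Cyclotomic.Basic
import HarnessLib

/-!
# Non-vacuity of `PeriodNV`, `PeriodThmF` (and of every `∀ Γ : Level V` binder) on the COR-CM universes

The stage-2 targets `HC_CM_of_PerLFace` / `HC_CM_of_PerL` (`CorCM/Interfaces.lean`) take the period theorem as a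
HYPOTHESIS.  Two structural traps would make that hypothesis trivially false or trivially true, independently of any
period integral:

* `Universe.PeriodNV ι₁ V K Ψ σ := ∃ Γ : Level V, …` (`CorCM/Geometry/Statements.lean`) is FALSE for every datum as soon as
  the type `Level V` of torsion-free congruence levels of `U(V₃,h)` is empty — then `PeriodThmF`, `PerL`, `PerL44` are false
  on every universe and both stage-2 targets hold vacuously;
* `Universe.PeriodThmF := ∀ F, IsGalois ℚ F → 6 ≤ [F:ℚ] → ∀ (f : Face F) ι₁, f.Admissible ι₁ → ∀ V : HermSpace3 F ι₁, …`
  is TRUE on every universe as soon as its binder prefix is uninhabited.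

This file closes both traps with kernel theorems (no new definition, no named fact):

* `Level.exists_Γ_eq_principalCongruenceSubgroup`, `Level.nonempty` — for EVERY hermitian 3-space `(V₃,h)/L` and every
  `n ≥ 3` the pair `(Γ(n), K_f(n𝓞_L))` is a `Level V`: `K_f(n𝓞_L) ≤ U(V₃,h)(𝔸_{L⁺,f})` is compact open
  (`UnitaryGroup.isCompact_finCongruenceLevel` / `isOpen_finCongruenceLevel`, Platonov–Rapinchuk 1994 §5.1),
  `U(V₃,h)(L⁺) ∩ K_f(n𝓞_L) = Γ(n)` (`UnitaryGroup.arithmeticLevel_finCongruenceLevel_span`, ibid. §4.1), and `Γ(n)` is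
  torsion-free by Minkowski's lemma (`ShimuraVarieties.torsionFree_principalCongruenceSubgroup`, Minkowski 1887).  This is the
  existence of torsion-free congruence subgroups asked for at the review of `CorCM/CM/Basic.lean` (`Level`'s first consumer).
* `nonempty_face`, `exists_face_admissible` — every CM field of degree `≥ 4` has a rank-four face (the CM type of the
  distinguished embeddings of its infinite places and two distinct places), and in degree `≥ 6` an admissible embedding
  for it (rfwf Lemma 2.1, tree `StubTree.admissible_exists`).
* `periodThmF_binders_inhabited` — the whole binder prefix of `PeriodThmF` down to the `∃ Γ : Level V` of `PeriodNV` is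
  inhabited: `F = ℚ(ζ₇)` (Galois, CM, degree `6`: tree `UnitaryGroup.isCMField_cyclotomicField_seven`,
  `UnitaryGroup.finrank_cyclotomicField_seven`, Mathlib `IsCyclotomicExtension.isGalois`), a face, an admissible `ι₁`,
  a hermitian space `V` (tree `landherr_exists_proof`) and a level (above).
* `Universe.exists_periodNV_of_periodThmF` — hence, on ANY universe `U`, `U.PeriodThmF` yields an actual instance of
  `U.PeriodNV`: the working hypothesis `PerLFace := PeriodThmF` of `HC_CM_of_PerLFace` is not a vacuous `∀`.

What is deliberately NOT here: the PerL-side prefix (`PerLHypothesesInhabited` of the package needs a non-Galois sextic CM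
field with its Galois closure of degree 24/48 as a `CMField`; package `HodgeCM/Model/SexticCM/*`, ≈ 1 200 lines), and the
period-free shadow `Universe.periodFree` (independence of `PeriodThmF` from the 28 model facts; package
`HodgeCM/Model/PeriodFree.lean`).
-/

noncomputable section

open NumberField NumberField.InfinitePlace

namespace Summit.HodgeConjecture.CorCM

open Literature.AlgebraicGeometry.Motives (CMType)
open Literature.AlgebraicGeometry.ShimuraVarieties
open Literature.NumberTheory.Automorphic (cmConjRingHom)
open Literature.NumberTheory.Automorphic

/-! ### Levels exist: `(Γ(n), K_f(n𝓞_L))` for `n ≥ 3` -/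

/-- `n 𝓞_L ≠ 0` for `n ≠ 0`. -/
theorem span_natCast_ringOfIntegers_ne_zero (L : CMField) {n : ℕ} (hn : n ≠ 0) :
    (Ideal.span {((n : ℕ) : 𝓞 L)} : Ideal (𝓞 L)) ≠ 0 := by
  rw [Ne, Ideal.zero_eq_bot, Ideal.span_singleton_eq_bot]
  exact_mod_cast hn

/-- **Principal congruence levels.** For every hermitian 3-space `(V₃,h)` over the CM field `L` and every `n ≥ 3`
there is a level `Γ : Level V` whose arithmetic group is the principal congruence subgroup
`Γ(n) = {γ ∈ U(V₃,h)(L⁺) ∣ γ ≡ 1, γ⁻¹ ≡ 1 (mod n)}`: it is cut out by the compact open principal finite congruence level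
`K_f(n𝓞_L)` (`U(L⁺) ∩ K_f(n𝓞_L) = Γ(n)`, Platonov–Rapinchuk 1994 §4.1/§5.1) and torsion-free by Minkowski's lemma
(Minkowski 1887; `torsionFree_principalCongruenceSubgroup`). -/
theorem Level.exists_Γ_eq_principalCongruenceSubgroup {L : CMField} {ι₁ : L →+* ℂ} (V : HermSpace3 L ι₁)
    {n : ℕ} (hn : 3 ≤ n) :
    ∃ Γ : Level V, Γ.Γ = principalCongruenceSubgroup (cmConjRingHom L) V.Hm n := by
  have hn0 : n ≠ 0 := by omega
  have h𝔫 := span_natCast_ringOfIntegers_ne_zero L hn0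
  exact ⟨{ Γ := principalCongruenceSubgroup (cmConjRingHom L) V.Hm n
           K := UnitaryGroup.finCongruenceLevel (↥(maximalRealSubfield L)) (L : Type) (IsCMField.complexConj L) 3 V.Hm
             (Ideal.span {((n : ℕ) : 𝓞 L)})
           isCompact_K := UnitaryGroup.isCompact_finCongruenceLevel (F := ↥(maximalRealSubfield L)) (E := (L : Type))
             (c := IsCMField.complexConj L) (N := 3) (J := V.Hm) h𝔫
           isOpen_K := UnitaryGroup.isOpen_finCongruenceLevel (F := ↥(maximalRealSubfield L)) (E := (L : Type))
             (c := IsCMField.complexConj L) (N := 3) (J := V.Hm) h𝔫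
           arithmeticLevel_K := by
             rw [UnitaryGroup.arithmeticLevel_finCongruenceLevel_span hn0]
             rfl
           torsionFree := torsionFree_principalCongruenceSubgroup _ _ hn }, rfl⟩

/-- **Non-vacuity of `Level V`.** Every hermitian 3-space over a CM field carries a torsion-free congruence level (e.g.
`Γ(3)`); in particular no binder `∃ Γ : Level V` / `∀ Γ : Level V` of `CorCM/Geometry/Statements.lean` (`PeriodNV`,
`PmsDimTwo`, …) is vacuous. -/
theorem Level.nonempty {L : CMField} {ι₁ : L →+* ℂ} (V : HermSpace3 L ι₁) : Nonempty (Level V) := by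
  obtain ⟨Γ, -⟩ := Level.exists_Γ_eq_principalCongruenceSubgroup V (le_refl 3)
  exact ⟨Γ⟩

/-! ### Faces exist over every CM field of degree `≥ 4`, admissible embeddings in degree `≥ 6` -/

/-- The set of distinguished embeddings `w.embedding` of the infinite places `w` of a CM field is a CM type (a CM field is
totally complex, so exactly one of `φ`, `φ̄` is the distinguished embedding of their common place). -/
theorem range_embedding_isCMType (K : CMField) (φ : K →+* ℂ) :
    φ ∈ Set.range (fun w : InfinitePlace K => w.embedding) ↔
      ComplexEmbedding.conjugate φ ∉ Set.range (fun w : InfinitePlace K => w.embedding) := by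
  constructor
  · rintro ⟨w, hw⟩ ⟨w', hw'⟩
    have h1 : w = mk φ := by rw [← hw, mk_embedding]
    have h2 : w' = mk φ := by rw [← mk_conjugate_eq, ← hw', mk_embedding]
    have h3 : ComplexEmbedding.conjugate φ = φ := by rw [← hw', h2, ← h1, hw]
    exact IsTotallyComplex.complexEmbedding_not_isReal φ (ComplexEmbedding.isReal_iff.mpr h3)
  · intro h
    rcases embedding_mk_eq φ with h1 | h1
    · exact ⟨mk φ, h1⟩
    · exact absurd ⟨mk φ, h1⟩ h

/-- **Faces exist.** A CM field of degree `≥ 4` has two distinct infinite places, hence a rank-four face `(Φ; π, π′)`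
(rfwf Def 1.1) on the CM type of distinguished embeddings. -/
theorem nonempty_face (F : CMField) (h4 : 4 ≤ Module.finrank ℚ F) : Nonempty (Face F) := by
  classical
  have hcard : 1 < Fintype.card (InfinitePlace F) := by
    have h1 := InfinitePlace.card_eq_nrRealPlaces_add_nrComplexPlaces (K := F)
    have h2 := IsTotallyComplex.finrank (K := F)
    have h3 := IsTotallyComplex.nrRealPlaces_eq_zero (K := F)
    omega
  obtain ⟨w, w', hww⟩ := Fintype.exists_pair_of_one_lt_card hcard
  exact ⟨{ Φ := ⟨Set.range (fun w : InfinitePlace F => w.embedding), range_embedding_isCMType F⟩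
           p := w.embedding
           p' := w'.embedding
           place_ne := by rwa [mk_embedding, mk_embedding] }⟩

/-- **Admissible face data exist** over every CM field of degree `≥ 6`: a face (`nonempty_face`) and an admissible
embedding for it (rfwf Lemma 2.1, `StubTree.admissible_exists`). -/
theorem exists_face_admissible (F : CMField) (h6 : 6 ≤ Module.finrank ℚ F) :
    ∃ (f : Face F) (ι₁ : F →+* ℂ), f.Admissible ι₁ := by
  obtain ⟨f⟩ := nonempty_face F (le_trans (by norm_num) h6)
  obtain ⟨ι₁, h⟩ := StubTree.admissible_exists F h6 f
  exact ⟨f, ι₁, h⟩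

/-! ### The binder prefix of `PeriodThmF` / `PeriodNV` is inhabited: `F = ℚ(ζ₇)` -/

/-- `ℚ(ζ₇)` is Galois over `ℚ`. -/
theorem isGalois_cyclotomicField_seven : IsGalois ℚ (CyclotomicField.{0} 7 ℚ) :=
  haveI : IsCyclotomicExtension {7} ℚ (CyclotomicField.{0} 7 ℚ) :=
    CyclotomicField.instIsCyclotomicExtensionSingletonNatSetOfCharZero 7 ℚ
  IsCyclotomicExtension.isGalois {7} ℚ (CyclotomicField.{0} 7 ℚ)

/-- **The binders of the period theorem are inhabited.** There are a Galois CM field `F` with `6 ≤ [F:ℚ]` (namely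
`ℚ(ζ₇)`), a rank-four face `f` of `F`, an admissible embedding `ι₁`, a hermitian 3-space `(V₃,h)/F` of signature
`(2,1)` at `ι₁` and `(3,0)` elsewhere (Landherr, `landherr_exists_proof`), and a torsion-free congruence level of
`U(V₃,h)` (`Level.nonempty`).  So `Universe.PeriodThmF` quantifies over a non-empty range and the leading `∃ Γ` of
`Universe.PeriodNV` ranges over a non-empty type. -/
theorem periodThmF_binders_inhabited :
    ∃ (F : CMField) (_ : IsGalois ℚ F) (_ : 6 ≤ Module.finrank ℚ F) (f : Face F) (ι₁ : F →+* ℂ)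
      (_ : f.Admissible ι₁) (V : HermSpace3 F ι₁), Nonempty (Level V) := by
  let F : CMField := ⟨CyclotomicField.{0} 7 ℚ⟩
  have hG : IsGalois ℚ F := isGalois_cyclotomicField_seven
  have h6 : 6 ≤ Module.finrank ℚ F := by
    change 6 ≤ Module.finrank ℚ (CyclotomicField.{0} 7 ℚ)
    rw [UnitaryGroup.finrank_cyclotomicField_seven]
  obtain ⟨f, ι₁, hf⟩ := exists_face_admissible F h6
  obtain ⟨V⟩ := landherr_exists_proof F ι₁
  exact ⟨F, hG, h6, f, ι₁, hf, V, Level.nonempty V⟩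

namespace Universe

variable (U : Universe)

/-- **`PeriodThmF` is not a vacuous `∀` on any universe**: if the period theorem in face form holds on `U`, then some
period datum `(F, f, ι₁, V)` exists and `U.PeriodNV ι₁ V F f.psi ι₁` holds for it — i.e. the hypothesis
`PerLFace := PeriodThmF` of the stage-2 target `HC_CM_of_PerLFace` asserts at least one genuine non-vanishing period
(with its level, morphisms and eigen-one-forms). -/
theorem exists_periodNV_of_periodThmF (h : U.PeriodThmF) :
    ∃ (F : CMField) (_ : IsGalois ℚ F) (_ : 6 ≤ Module.finrank ℚ F) (f : Face F) (ι₁ : F →+* ℂ)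
      (_ : f.Admissible ι₁) (V : HermSpace3 F ι₁), U.PeriodNV ι₁ V F f.psi ι₁ := by
  obtain ⟨F, hG, h6, f, ι₁, hf, V, -⟩ := periodThmF_binders_inhabited
  exact ⟨F, hG, h6, f, ι₁, hf, V, h F hG h6 f ι₁ hf V⟩

/-- On every universe, every instance of the `∀ Γ : Level V` model fact `PmsDimTwo` has content: for every hermitian
3-space there IS a Picard modular surface `P_Γ` in the universe to which it applies (a level `Γ` exists). -/
theorem exists_dim_pms_eq_two_of_pmsDimTwo (h : U.PmsDimTwo) {L : CMField} (ι₁ : L →+* ℂ) (V : HermSpace3 L ι₁) :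
    ∃ Γ : Level V, U.dim (U.pms L ι₁ V Γ) = 2 := by
  obtain ⟨Γ⟩ := Level.nonempty V
  exact ⟨Γ, h L ι₁ V Γ⟩

end Universe

end Summit.HodgeConjecture.CorCM

end
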